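import Literature.NumberTheory.Transcendental.SemistableReduction
import Mathlib.LinearAlgebra.LinearIndependent.BaseChange
import Mathlib.LinearAlgebra.Dual.Lemmas
import HarnessLib

/-!
# `K`-rational subspaces of `L^σ`: points, dimension, intersections, span descent

Topic: `Literature/NumberTheory/Transcendental`. Support for the closing argument of Baker's
method on `M_κ` (plan item W4, "index descent", of the unit
`provefact-Literature.NumberTheory.Transcendental.H-b596640137`): Philippon's zero estimate
produces an obstruction subgroup defined over `ℂ`, while semistability
(`SemistableQuotients.Semistable`) quantifies over subgroups defined over `ℚ̄`; the comparison is
linear algebra of `K`-rational subspaces (`LiePresentation.IsKRational`,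
`SemistableReduction.lean`). PROVED here, for a field extension `L/K` and a finite index type `σ`:

* `kPoints W` — the `K`-points `W ∩ K^σ` of a subspace `W ≤ L^σ` (a `K`-subspace of `K^σ`, the
  preimage under Mathlib's `Pi.algebraMap σ K L`), and
  `IsKRational.eq_span_kPoints` — a `K`-rational `W` is spanned by its `K`-points;
* `coeff_mem_span` — **coefficient lemma**: for a `K`-independent finite family `b` in `K^σ`
  and `w ∈ span_L(b)`, the coefficient vectors of `w` in a `K`-basis of `L` lie in `span_K(b)`;
* `kPoints_span_ofK` — **span descent**: `kPoints (span_L (ofK '' S)) = span_K S`;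
* `IsKRational.finrank_eq` — `dim_L W = dim_K (kPoints W)` (Mathlib's
  `linearIndependent_algebraMap_comp_iff` for the base change of independence);
* `IsKRational.inf` — intersections of `K`-rational subspaces are `K`-rational;
* `IsKRational.exists_le_le_finrank_eq` — between `K`-rational `W ≤ V` there are `K`-rational
  subspaces of every intermediate dimension.

## References

* A. Baker, G. Wüstholz, *Logarithmic Forms and Diophantine Geometry*, CUP 2007, §6.1–6.2
  (subspaces defined over `ℚ̄`).
-/

noncomputable section

open Module Submodule

namespace Literature.NumberTheory.Transcendental

namespace LiePresentation

variable (K : Type*) {L : Type*} [Field K] [Field L] [Algebra K L] {σ : Type*}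

/-! ### `K`-points -/

/-- Mathlib's componentwise algebra map `Pi.algebraMap σ K L : K^σ →ₗ[K] L^σ` is the `K`-linear
version of `ofK`. [folklore] -/
@[simp] theorem piAlgebraMap_apply (v : σ → K) : Pi.algebraMap σ K L v = ofK K v := rfl

/-- `ofK` is injective. [folklore] -/
theorem ofK_injective : Function.Injective (ofK K (L := L) (σ := σ)) := by
  intro v w h
  funext i
  have := congrFun h i
  simpa [ofK] using this

/-- **The `K`-points** `W ∩ K^σ` of a subspace `W ≤ L^σ`, as a `K`-subspace of `K^σ`. [folklore] -/
def kPoints (W : Submodule L (σ → L)) : Submodule K (σ → K) :=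
  (W.restrictScalars K).comap (Pi.algebraMap σ K L)

/-- Membership in the `K`-points. [folklore] -/
@[simp] theorem mem_kPoints {W : Submodule L (σ → L)} {v : σ → K} : v ∈ kPoints K W ↔ ofK K v ∈ W :=
  Iff.rfl

/-- `kPoints` is monotone. [folklore] -/
theorem kPoints_mono {W W' : Submodule L (σ → L)} (h : W ≤ W') : kPoints K W ≤ kPoints K W' :=
  fun _ hv => h hv

/-- The span of the `K`-points is contained in the subspace. [folklore] -/
theorem span_kPoints_le (W : Submodule L (σ → L)) : span L (ofK K '' (kPoints K W : Set (σ → K))) ≤ W :=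
  span_le.mpr (by rintro _ ⟨v, hv, rfl⟩; exact hv)

/-- **A `K`-rational subspace is spanned by its `K`-points.** [folklore] -/
theorem IsKRational.eq_span_kPoints {W : Submodule L (σ → L)} (h : IsKRational K W) :
    W = span L (ofK K '' (kPoints K W : Set (σ → K))) := by
  refine le_antisymm ?_ (span_kPoints_le K W)
  obtain ⟨s, hs⟩ := h
  have hsub : s ⊆ (kPoints K W : Set (σ → K)) := fun v hv => by
    show ofK K v ∈ W
    rw [hs]; exact subset_span ⟨v, hv, rfl⟩
  calc W = span L (ofK K '' s) := hs
    _ ≤ span L (ofK K '' (kPoints K W : Set (σ → K))) := span_mono (Set.image_mono hsub)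

/-! ### The coefficient lemma and span descent -/

/-- `ofK` of a `K`-combination is the `L`-combination of the `ofK`. [folklore] -/
theorem ofK_sum_smul {ι : Type*} (s : Finset ι) (a : ι → K) (b : ι → σ → K) :
    ofK K (L := L) (∑ i ∈ s, a i • b i) = ∑ i ∈ s, algebraMap K L (a i) • ofK K (b i) := by
  funext j
  simp [ofK, map_sum, Finset.sum_apply, Algebra.smul_def]

/-- **Coefficient lemma.** Let `b : Fin n → K^σ` be a family, `c` a `K`-basis of `L`, and
`w ∈ span_L(ofK ∘ b)`. Then for every basis index `j` the `j`-th coefficient vector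
`(c.repr (w k) j)_k` of `w` lies in `span_K(b)`. [folklore] -/
theorem coeff_mem_span {n : ℕ} (b : Fin n → σ → K)
    {ιc : Type*} (c : Basis ιc K L) {w : σ → L} (hw : w ∈ span L (Set.range fun i => ofK K (L := L) (b i)))
    (j : ιc) : (fun k => c.repr (w k) j) ∈ span K (Set.range b) := by
  -- write `w = ∑ a_i • ofK (b i)`
  obtain ⟨a, rfl⟩ := (Submodule.mem_span_range_iff_exists_fun L).mp hw
  -- the `j`-th coefficient vector is `∑_i (c.repr (a i) j) • b i`
  have e : (fun k => c.repr ((∑ i, a i • ofK K (L := L) (b i)) k) j) = ∑ i, (c.repr (a i) j) • b i := by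
    funext k
    simp only [Finset.sum_apply, Pi.smul_apply, ofK_apply, map_sum, Finsupp.coe_finsetSum,
      smul_eq_mul]
    refine Finset.sum_congr rfl fun i _ => ?_
    rw [show a i * algebraMap K L (b i k) = b i k • a i from by rw [Algebra.smul_def, mul_comm],
      map_smul, Finsupp.smul_apply, smul_eq_mul, mul_comm]
  rw [e]
  exact Submodule.sum_mem _ fun i _ => Submodule.smul_mem _ _ (subset_span ⟨i, rfl⟩)

variable [Fintype σ]

/-- **Span descent.** The `K`-points of the `L`-span of a set of `K`-vectors form its `K`-span:
a `K`-vector which is an `L`-combination of `K`-vectors is a `K`-combination of them. [folklore] -/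
theorem kPoints_span_ofK (S : Set (σ → K)) :
    kPoints K (span L (ofK K (L := L) '' S)) = span K S := by
  refine le_antisymm ?_ ?_
  · intro u hu
    rw [mem_kPoints] at hu
    -- a `K`-basis of `span_K S`, reindexed by `Fin n`
    set V := span K S with hV
    haveI : FiniteDimensional K V := FiniteDimensional.finiteDimensional_submodule V
    let bV := Module.finBasis K V
    set n := Module.finrank K V
    let b : Fin n → σ → K := fun i => (bV i : σ → K)
    -- `span_L (ofK '' S) ≤ span_L (ofK ∘ b)`
    have hle : span L (ofK K (L := L) '' S) ≤ span L (Set.range fun i => ofK K (L := L) (b i)) := by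
      refine span_le.mpr ?_
      rintro _ ⟨v, hv, rfl⟩
      have hvV : v ∈ V := subset_span hv
      have hrepr := bV.sum_repr ⟨v, hvV⟩
      have hv' : v = ∑ i, (bV.repr ⟨v, hvV⟩ i) • b i := by
        have h1 := congrArg Subtype.val hrepr
        simp only [Submodule.coe_sum, Submodule.coe_smul] at h1
        exact h1.symm
      rw [hv', ofK_sum_smul]
      exact Submodule.sum_mem _ fun i _ => Submodule.smul_mem _ _ (subset_span ⟨i, rfl⟩)
    -- the coefficient vector of `ofK u` at the index of `1`
    let c := Basis.ofVectorSpace K L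
    obtain ⟨j₀, hj₀⟩ : ∃ j, c.repr 1 j ≠ 0 := by
      by_contra! h0
      have : c.repr (1 : L) = 0 := Finsupp.ext h0
      exact one_ne_zero (c.repr.injective (by rw [this, map_zero]))
    have hcoef := coeff_mem_span K b c (hle hu) j₀
    have e : (fun k => c.repr (ofK K (L := L) u k) j₀) = (c.repr 1 j₀) • u := by
      funext k
      simp [ofK, Algebra.algebraMap_eq_smul_one, mul_comm]
    rw [e] at hcoef
    have hbV : span K (Set.range b) ≤ V := span_le.mpr (by rintro _ ⟨i, rfl⟩; exact (bV i).2)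
    have := hbV hcoef
    rwa [V.smul_mem_iff hj₀] at this
  · refine span_le.mpr fun v hv => ?_
    show ofK K v ∈ span L (ofK K '' S)
    exact subset_span ⟨v, hv, rfl⟩

/-! ### Reconstruction from coefficient vectors -/

/-- **Reconstruction.** Every `w ∈ L^σ` is `∑_j c_j • ofK(w_j)` over a finite set of basis
indices, `w_j` the `j`-th coefficient vector in the `K`-basis `c` of `L`. [folklore] -/
theorem eq_sum_smul_ofK_coeff {ιc : Type*} (c : Basis ιc K L) (w : σ → L) :
    ∃ S : Finset ιc, w = ∑ j ∈ S, c j • ofK K (L := L) (fun k => c.repr (w k) j) := by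
  classical
  refine ⟨Finset.univ.biUnion fun k => (c.repr (w k)).support, ?_⟩
  funext i
  simp only [Finset.sum_apply, Pi.smul_apply, ofK_apply, smul_eq_mul]
  set S : Finset ιc := Finset.univ.biUnion fun k => (c.repr (w k)).support
  have hsub : (c.repr (w i)).support ⊆ S := fun j hj =>
    Finset.mem_biUnion.mpr ⟨i, Finset.mem_univ _, hj⟩
  have h1 := c.linearCombination_repr (w i)
  rw [Finsupp.linearCombination_apply, Finsupp.sum_of_support_subset (c.repr (w i)) hsub
    (fun j a => a • c j) (fun j _ => zero_smul K (c j))] at h1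
  calc w i = ∑ j ∈ S, (c.repr (w i)) j • c j := h1.symm
    _ = ∑ j ∈ S, c j * algebraMap K L (c.repr (w i) j) :=
        Finset.sum_congr rfl fun j _ => by rw [Algebra.smul_def, mul_comm]

/-- **Coefficient vectors of an element of a `K`-rational subspace are `K`-points of it.**
[folklore] -/
theorem IsKRational.coeff_mem_kPoints {W : Submodule L (σ → L)} (h : IsKRational K W)
    {ιc : Type*} (c : Basis ιc K L) {w : σ → L} (hw : w ∈ W) (j : ιc) :
    (fun k => c.repr (w k) j) ∈ kPoints K W := by
  -- a `K`-basis of the `K`-points, reindexed by `Fin n`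
  set V := kPoints K W with hV
  haveI : FiniteDimensional K V := FiniteDimensional.finiteDimensional_submodule V
  let bV := Module.finBasis K V
  let b : Fin (Module.finrank K V) → σ → K := fun i => (bV i : σ → K)
  have hle : W ≤ span L (Set.range fun i => ofK K (L := L) (b i)) := by
    rw [h.eq_span_kPoints]
    refine span_le.mpr ?_
    rintro _ ⟨v, hv, rfl⟩
    have hrepr := bV.sum_repr ⟨v, hv⟩
    have hv' : v = ∑ i, (bV.repr ⟨v, hv⟩ i) • b i := by
      have h1 := congrArg Subtype.val hrepr
      simp only [Submodule.coe_sum, Submodule.coe_smul] at h1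
      exact h1.symm
    rw [hv', ofK_sum_smul]
    exact Submodule.sum_mem _ fun i _ => Submodule.smul_mem _ _ (subset_span ⟨i, rfl⟩)
  have hcoef := coeff_mem_span K b c (hle hw) j
  have hbV : span K (Set.range b) ≤ V := span_le.mpr (by rintro _ ⟨i, rfl⟩; exact (bV i).2)
  exact hbV hcoef

/-! ### Dimension and intersections -/

/-- **`dim_L W = dim_K (W ∩ K^σ)` for `K`-rational `W`.** [folklore] -/
theorem IsKRational.finrank_eq {W : Submodule L (σ → L)} (h : IsKRational K W) :
    Module.finrank L W = Module.finrank K (kPoints K W) := by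
  set V := kPoints K W with hV
  haveI : FiniteDimensional K V := FiniteDimensional.finiteDimensional_submodule V
  let bV := Module.finBasis K V
  set n := Module.finrank K V
  let b : Fin n → σ → K := fun i => (bV i : σ → K)
  have hb : LinearIndependent K b := bV.linearIndependent.map' V.subtype (Submodule.ker_subtype V)
  have hind : LinearIndependent L (fun i j => algebraMap K L (b i j)) :=
    linearIndependent_algebraMap_comp_iff.mpr hb
  have hspan : span L (Set.range fun i j => algebraMap K L (b i j)) = W := by
    refine le_antisymm (span_le.mpr ?_) ?_
    · rintro _ ⟨i, rfl⟩
      exact (bV i).2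
    · rw [h.eq_span_kPoints]
      refine span_le.mpr ?_
      rintro _ ⟨v, hv, rfl⟩
      have hrepr := bV.sum_repr ⟨v, hv⟩
      have hv' : v = ∑ i, (bV.repr ⟨v, hv⟩ i) • b i := by
        have h1 := congrArg Subtype.val hrepr
        simp only [Submodule.coe_sum, Submodule.coe_smul] at h1
        exact h1.symm
      rw [hv', ofK_sum_smul]
      exact Submodule.sum_mem _ fun i _ => Submodule.smul_mem _ _ (subset_span ⟨i, rfl⟩)
  rw [← hspan, finrank_span_eq_card hind, Fintype.card_fin]

omit [Fintype σ] in
/-- `kPoints (W ⊓ W') = kPoints W ⊓ kPoints W'`. [folklore] -/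
theorem kPoints_inf (W W' : Submodule L (σ → L)) : kPoints K (W ⊓ W') = kPoints K W ⊓ kPoints K W' := by
  ext v; simp [kPoints]

/-- **Intersections of `K`-rational subspaces are `K`-rational.** [folklore] -/
theorem IsKRational.inf {W W' : Submodule L (σ → L)} (h : IsKRational K W) (h' : IsKRational K W') :
    IsKRational K (W ⊓ W') := by
  refine ⟨(kPoints K (W ⊓ W') : Set (σ → K)), le_antisymm ?_ (span_kPoints_le K _)⟩
  intro w hw
  let c := Basis.ofVectorSpace K L
  obtain ⟨S, hS⟩ := eq_sum_smul_ofK_coeff K c w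
  rw [hS]
  refine Submodule.sum_mem _ fun j _ => Submodule.smul_mem _ _ (subset_span ⟨_, ?_, rfl⟩)
  rw [SetLike.mem_coe, kPoints_inf]
  exact ⟨h.coeff_mem_kPoints K c hw.1 j, h'.coeff_mem_kPoints K c hw.2 j⟩

omit [Fintype σ] in
/-- The span of `K`-vectors is `K`-rational. [folklore] -/
theorem isKRational_span_ofK (S : Set (σ → K)) : IsKRational K (span L (ofK K (L := L) '' S)) :=
  ⟨S, rfl⟩

/-- The `L`-span of a `K`-subspace `V ≤ K^σ` has dimension `dim_K V`. [folklore] -/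
theorem finrank_span_ofK (V : Submodule K (σ → K)) :
    Module.finrank L (span L (ofK K (L := L) '' (V : Set (σ → K)))) = Module.finrank K V := by
  rw [(isKRational_span_ofK K (V : Set (σ → K))).finrank_eq, kPoints_span_ofK, span_eq]

/-! ### Intermediate `K`-rational subspaces -/

/-- **Intermediate `K`-rational subspaces of prescribed dimension.** If `W ≤ V` are `K`-rational
and `dim W ≤ m ≤ dim V` then there is a `K`-rational `W'` with `W ≤ W' ≤ V` and `dim W' = m`.
[folklore] -/
theorem IsKRational.exists_le_le_finrank_eq {W V : Submodule L (σ → L)} (hW : IsKRational K W)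
    (hV : IsKRational K V) (hWV : W ≤ V) {m : ℕ} (h1 : Module.finrank L W ≤ m) (h2 : m ≤ Module.finrank L V) :
    ∃ W' : Submodule L (σ → L), IsKRational K W' ∧ W ≤ W' ∧ W' ≤ V ∧ Module.finrank L W' = m := by
  -- work with the `K`-points
  rw [hW.finrank_eq] at h1
  rw [hV.finrank_eq] at h2
  have hWVK : kPoints K W ≤ kPoints K V := kPoints_mono K hWV
  -- an intermediate `K`-subspace of dimension `m`
  obtain ⟨U, hWU, hUV, hU⟩ : ∃ U : Submodule K (σ → K), kPoints K W ≤ U ∧ U ≤ kPoints K V ∧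
      Module.finrank K U = m := by
    -- induction on `m - dim W`
    suffices key : ∀ d : ℕ, ∀ U₀ : Submodule K (σ → K), kPoints K W ≤ U₀ → U₀ ≤ kPoints K V →
        Module.finrank K U₀ + d ≤ Module.finrank K (kPoints K V) →
        ∃ U : Submodule K (σ → K), U₀ ≤ U ∧ U ≤ kPoints K V ∧ Module.finrank K U = Module.finrank K U₀ + d by
      obtain ⟨U, h0U, hUV, hU⟩ := key (m - Module.finrank K (kPoints K W)) (kPoints K W) le_rfl hWVK (by omega)
      exact ⟨U, h0U, hUV, by omega⟩
    intro d
    induction d with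
    | zero => intro U₀ h0 hV' _; exact ⟨U₀, le_rfl, hV', rfl⟩
    | succ d ih =>
      intro U₀ h0 hV' hd
      obtain ⟨U, h0U, hUV, hU⟩ := ih U₀ h0 hV' (by omega)
      -- `U < kPoints V`: pick a vector outside
      have hlt : U < kPoints K V := by
        refine lt_of_le_of_ne hUV fun heq => ?_
        rw [heq] at hU; omega
      obtain ⟨v, hvV, hvU⟩ := SetLike.exists_of_lt hlt
      refine ⟨U ⊔ span K {v}, h0U.trans le_sup_left, sup_le hUV (span_le.mpr (by simpa using hvV)), ?_⟩
      haveI : FiniteDimensional K U := FiniteDimensional.finiteDimensional_submodule U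
      have hdisj : U ⊓ span K {v} = ⊥ := by
        rw [Submodule.eq_bot_iff]
        rintro x ⟨hxU, hxv⟩
        obtain ⟨a, rfl⟩ := Submodule.mem_span_singleton.mp hxv
        by_cases ha : a = 0
        · simp [ha]
        · exact absurd ((U.smul_mem_iff ha).mp hxU) hvU
      have hv0 : v ≠ 0 := fun h => hvU (h ▸ U.zero_mem)
      have := Submodule.finrank_sup_add_finrank_inf_eq U (span K {v})
      rw [hdisj, finrank_bot, add_zero, finrank_span_singleton hv0] at this
      omega
  refine ⟨span L (ofK K '' (U : Set (σ → K))), isKRational_span_ofK K _, ?_, ?_, ?_⟩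
  · rw [hW.eq_span_kPoints]; exact span_mono (Set.image_mono hWU)
  · rw [hV.eq_span_kPoints]; exact span_mono (Set.image_mono hUV)
  · rw [finrank_span_ofK, hU]

/-! ### Annihilators for the dot product -/

/-- The annihilator of `Θ ≤ L^σ` for the dot product: `{u | ∀ θ ∈ Θ, ∑ᵢ θᵢ uᵢ = 0}`. [folklore] -/
def dotAnn (Θ : Submodule L (σ → L)) : Submodule L (σ → L) where
  carrier := {u | ∀ θ ∈ Θ, ∑ i, θ i * u i = 0}
  zero_mem' := fun θ _ => by simp
  add_mem' := by
    intro u v hu hv θ hθ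
    simp only [Pi.add_apply, mul_add, Finset.sum_add_distrib, hu θ hθ, hv θ hθ, add_zero]
  smul_mem' := by
    intro c u hu θ hθ
    simp only [Pi.smul_apply, smul_eq_mul, mul_left_comm _ c, ← Finset.mul_sum, hu θ hθ, mul_zero]

/-- Membership in the annihilator. [folklore] -/
theorem mem_dotAnn {Θ : Submodule L (σ → L)} {u : σ → L} : u ∈ dotAnn Θ ↔ ∀ θ ∈ Θ, ∑ i, θ i * u i = 0 :=
  Iff.rfl

/-- The annihilator through the standard duality `L^σ ≃ (L^σ)^*`. [folklore] -/
theorem dotAnn_eq_comap [DecidableEq σ] (Θ : Submodule L (σ → L)) :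
    dotAnn Θ = Θ.dualAnnihilator.comap ((Pi.basisFun L σ).toDualEquiv : (σ → L) →ₗ[L] Module.Dual L (σ → L)) := by
  have key : ∀ u θ : σ → L, (Pi.basisFun L σ).toDual u θ = ∑ i, θ i * u i := by
    intro u θ
    conv_lhs => rw [← (Pi.basisFun L σ).sum_repr θ]
    simp only [map_sum, map_smul, Basis.toDual_apply_left, Pi.basisFun_repr, smul_eq_mul]
  ext u
  rw [mem_dotAnn, Submodule.mem_comap, Submodule.mem_dualAnnihilator]
  change _ ↔ ∀ θ ∈ Θ, (Pi.basisFun L σ).toDual u θ = 0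
  simp only [key]

/-- **`dim dotAnn Θ + dim Θ = |σ|`.** [folklore] -/
theorem finrank_dotAnn_add (Θ : Submodule L (σ → L)) :
    Module.finrank L (dotAnn Θ) + Module.finrank L Θ = Fintype.card σ := by
  classical
  rw [dotAnn_eq_comap]
  set e := ((Pi.basisFun L σ).toDualEquiv : (σ → L) ≃ₗ[L] Module.Dual L (σ → L))
  have h1 : Module.finrank L (Θ.dualAnnihilator.comap (e : (σ → L) →ₗ[L] Module.Dual L (σ → L))) =
      Module.finrank L Θ.dualAnnihilator := by
    rw [show Θ.dualAnnihilator.comap (e : (σ → L) →ₗ[L] Module.Dual L (σ → L)) = Θ.dualAnnihilator.map (e.symm : _ →ₗ[L] _)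
      from (Submodule.map_equiv_eq_comap_symm e.symm Θ.dualAnnihilator).symm ▸ by simp]
    exact LinearEquiv.finrank_map_eq e.symm _
  rw [h1, add_comm]
  have := Subspace.finrank_add_finrank_dualAnnihilator_eq Θ
  simpa using this

/-- **Annihilators of `K`-rational subspaces are `K`-rational**: `dotAnn Θ` is the solution space
of the `K`-forms given by the `K`-points of `Θ`. [folklore] -/
theorem IsKRational.dotAnn {Θ : Submodule L (σ → L)} (h : IsKRational K Θ) :
    IsKRational K (LiePresentation.dotAnn Θ) := by
  have e : LiePresentation.dotAnn Θ = solSpace K (L := L) (kPoints K Θ : Set (σ → K)) := by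
    ext u
    simp only [mem_dotAnn, mem_solSpace, pair]
    constructor
    · intro hu β hβ
      have := hu (ofK K β) hβ
      simpa [ofK] using this
    · intro hu θ hθ
      -- `θ` is an `L`-combination of `K`-points
      rw [h.eq_span_kPoints] at hθ
      refine Submodule.span_induction ?_ ?_ ?_ ?_ hθ
      · rintro _ ⟨β, hβ, rfl⟩
        simpa [ofK] using hu β hβ
      · simp
      · intro x y _ _ hx hy
        simp only [Pi.add_apply, add_mul, Finset.sum_add_distrib, hx, hy, add_zero]
      · intro a x _ hx
        simp only [Pi.smul_apply, smul_eq_mul, mul_assoc, ← Finset.mul_sum, hx, mul_zero]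
  rw [e]
  exact isKRational_solSpace K _

end LiePresentation

end Literature.NumberTheory.Transcendental

end
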